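import Literature.Geometry.Symplectic.FoldFormsFourFoldsSteinGlue
import Literature.Geometry.Symplectic.KahlerDecompositionIsotopy
import Literature.Geometry.Symplectic.KahlerDecompositionSphere
import HarnessLib

/-!
# Folded symplectic forms on Stein gluings, on doubles of Stein domains and on `S⁴`

Topic `Literature/Geometry/Symplectic`; namespace `Literature.Geometry.Symplectic`.  Sibling of
`FoldFormsFourFoldsSteinGlue.lean`, whose conditional theorem
`cannasDaSilva2010_foldedForm_of_orientable_of_kahlerDecomposition` proves Cannas da Silva's
Theorem 2 (`CannasDaSilva2010_foldedForm_of_orientable`) from the named fact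
`baykur_kahlerDecomposition` ([cite: Baykur2006, Thm. 5.1]).  This file records the
UNCONDITIONAL content of that pipeline — the folded form exists on every closed 4-manifold that
IS a Stein gluing with matching boundary plane fields — and its two classical instances, which
are genuine theorems of the tree (no named fact is assumed):

* Baykur 2006, Thm. 6.1 (the gluing step of its proof, p. 1254 = arXiv p. 15: *"add collars …
  apply the folding … `(N, ω|_N) ≅ ([−1,1] × H, d((t²+1)π^*α))`"*): a closed 4-manifold
  `X = W₁ ∪_ψ W₂` glued from two compact Stein domains along a diffeomorphism of the boundaries
  matching the fields of complex tangencies carries a folded symplectic form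
  (`exists_def_one_of_steinGluing`, `exists_isFoldedForm_of_steinGluing`); the print-literal
  "isotopic contact structures" version follows by Gray stability as recorded in
  `KahlerDecompositionIsotopy.lean` (`exists_isFoldedForm_of_steinGluing_isotopic`).
* Doubles: *"The easiest examples are doubles. If `Y⁴` is a compact Kähler manifold with strictly
  pseudoconvex boundary, then `X = Y ∪ −Y` is equipped with a folded Kähler structure. When `Y`
  is indeed Stein, we get a nicely folded structure"* ([cite: Baykur2006, §6 Example 2]); *"Doubles
  of symplectic manifolds with `ω`-convex (or `ω`-concave) boundary are easy examples of manifolds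
  with folded symplectic forms"* ([cite: Cannasdasilva2010, §2]) — here for compact Stein domains
  of complex dimension 2: `exists_isFoldedForm_of_isDouble`, `exists_isDouble_isFoldedForm`.
* The 4-sphere: *"Simplest instances are the spheres `S²ⁿ`"* ([cite: Cannasdasilva2010, §2]);
  *"the standard folded symplectic form `ω₀` on `S⁴`"*, the double of the standard `D⁴ ⊂ ℂ²`
  ([cite: Baykur2006, §3 and §6 Example 2]): `exists_isFoldedForm_sphere_four` and, for every
  smooth 4-manifold diffeomorphic to `S⁴`, `exists_isFoldedForm_of_diffeomorph_sphere_four`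
  (via `baykur_kahlerDecomposition_sphere`, `KahlerDecompositionSphere.lean`, proved).

All statements conclude with the datum of `CannasDaSilva2010_foldedForm_of_orientable`
(`∃ s N j, IsFoldedForm s N j`, `OrigamiForm.lean` = Def. 1 of [cite: Cannasdasilva2010] for
`n = 2`), obtained from the Def. 1 clauses by `exists_isFoldedForm_of_transverse'`
(`FoldFormsFourFoldsProofs.lean`).

## References

* R. İ. Baykur, *Kähler decomposition of 4-manifolds*, Algebr. Geom. Topol. 6 (2006) 1239–1265,
  Thm. 6.1, §3, §6 Example 2. [Baykur2006]
* A. Cannas da Silva, *Fold-forms for four-folds*, J. Symplectic Geom. 8 (2010) 189–203, §2 and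
  Thm. 2. [Cannasdasilva2010]
-/

noncomputable section

open scoped Manifold ContDiff Topology
open Set Function Filter
open Literature.Geometry.Kaehler Literature.Topology.FourManifolds

namespace Literature.Geometry.Symplectic

section SteinGluing

variable {X : Type} [TopologicalSpace X] [T2Space X] [CompactSpace X]
  [ChartedSpace (EuclideanSpace ℝ (Fin 4)) X] [IsManifold (𝓡 4) ∞ X]
  {W₁ : Type} [TopologicalSpace W₁] [ChartedSpace (EuclideanHalfSpace 4) W₁]
  [IsManifold (𝓡∂ 4) ∞ W₁] [CompactSpace W₁]
  {W₂ : Type} [TopologicalSpace W₂] [ChartedSpace (EuclideanHalfSpace 4) W₂]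
  [IsManifold (𝓡∂ 4) ∞ W₂] [CompactSpace W₂]

omit [CompactSpace X] in
/-- **The folded form on a Stein gluing (Baykur 2006, proof of Thm. 6.1), Def. 1 clauses.**  If the
closed 4-manifold `X` is a gluing `W₁ ∪_ψ W₂` of two compact Stein domains along a
diffeomorphism `ψ` of boundary data under which the two fields of maximal complex tangencies of
the boundaries coincide pointwise, then `X` carries a smooth closed `2`-form whose chart
Pfaffian vanishes transversally along its fold and whose restriction to the fold has maximal
rank (Def. 1 of [cite: Cannasdasilva2010]): glue Baykur's form `ω₊ ∪ d((t² + 1)α) ∪ ω₋` on the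
model gluing (`exists_def_one_steinGlue`) and transport it along `X ≅ P` (uniqueness of
gluings, `nonempty_diffeomorph_of_isBoundaryGluing_holds`; `def_one_pullback_diffeomorph`).
[cite: Baykur2006, Thm. 6.1] -/
theorem exists_def_one_of_steinGluing (S₁ : SteinStructure W₁) (S₂ : SteinStructure W₂)
    (b₁ : BoundaryData (𝓡∂ 4) W₁ (𝓡 3)) (b₂ : BoundaryData (𝓡∂ 4) W₂ (𝓡 3))
    (ψ : b₁.carrier ≃ₘ⟮𝓡 3, 𝓡 3⟯ b₂.carrier)
    (hplane : ∀ z, Submodule.map (mfderiv (𝓡 3) (𝓡∂ 4) (b₂.incl ∘ ψ) z).toLinearMap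
      (boundaryPlaneField S₁.J b₁ z) = contactPlane S₂.J (b₂.incl (ψ z)))
    (hglue : IsBoundaryGluing b₁ b₂ ψ (𝓡 4) X) :
    ∃ s : MForm (𝓡 4) X ℝ 2, IsSmoothForm s ∧ IsClosedForm s ∧
      (∀ z ∈ fold s, fderiv ℝ (fun y => pfaffian (s.inChart z y)) (extChartAt (𝓡 4) z z) ≠ 0) ∧
      (∀ z ∈ fold s, ∃ v : TangentSpace (𝓡 4) z, (∀ w, s z ![v, w] = 0) ∧
        fderiv ℝ (fun y => pfaffian (s.inChart z y)) (extChartAt (𝓡 4) z z) v ≠ 0) := by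
  rcases isEmpty_or_nonempty X with hXe | hXn
  · -- the empty manifold: the zero form, all clauses vacuous
    exact ⟨0, isSmoothForm_zero, Literature.Geometry.Kaehler.mextDeriv_zero,
      fun z => isEmptyElim z, fun z => isEmptyElim z⟩
  obtain ⟨hT₁, hT₂⟩ := IsBoundaryGluing.t2Space_pieces hglue
  haveI := hT₁
  haveI := hT₂
  -- the common boundary is non-empty
  haveI : Nonempty b₁.carrier := by
    obtain ⟨x⟩ := hXn
    obtain ⟨jA, jB, -, -, hU, -⟩ := hglue
    have hx : x ∈ range jA ∪ range jB := by rw [hU]; exact mem_univ x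
    rcases hx with ⟨a, -⟩ | ⟨c, -⟩
    · haveI : Nonempty W₁ := ⟨a⟩
      exact S₁.nonempty_carrier b₁
    · haveI : Nonempty W₂ := ⟨c⟩
      obtain ⟨y⟩ := S₂.nonempty_carrier b₂
      exact ⟨ψ.symm y⟩
  -- Liouville collars of the two pieces
  obtain ⟨c₀, hc₀, hreg⟩ := S₁.exists_liouvilleFlowout_params
  obtain ⟨c₀', hc₀', hreg'⟩ := S₂.exists_liouvilleFlowout_params
  have hc : c₀ < (c₀ + sSup (range S₁.φ)) / 2 := by linarith
  have hc₁ : (c₀ + sSup (range S₁.φ)) / 2 < sSup (range S₁.φ) := by linarith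
  have hc' : c₀' < (c₀' + sSup (range S₂.φ)) / 2 := by linarith
  have hc₁' : (c₀' + sSup (range S₂.φ)) / 2 < sSup (range S₂.φ) := by linarith
  obtain ⟨Γ₁⟩ := (S₁.liouvilleFlowout hc hc₁ hreg).nonempty_cover
  obtain ⟨Γ₂⟩ := (S₂.liouvilleFlowout hc' hc₁' hreg').nonempty_cover
  -- the folded form on the model gluing
  obtain ⟨t, hts, htc, -, htmax⟩ := exists_def_one_steinGlue S₁ rfl Γ₁ b₁ S₂ rfl Γ₂ b₂ ψ hplane
  -- `X ≅ P`
  have hP : IsBoundaryGluing b₁ (reindexBoundaryData b₂ ψ) (steinGlueData Γ₁ b₁ Γ₂ b₂ ψ).φ (𝓡 4)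
      (steinGlueData Γ₁ b₁ Γ₂ b₂ ψ).d₂.Glued :=
    (steinGlueData Γ₁ b₁ Γ₂ b₂ ψ).isBoundaryGluing
  have hXg : IsBoundaryGluing b₁ (reindexBoundaryData b₂ ψ) (steinGlueData Γ₁ b₁ Γ₂ b₂ ψ).φ (𝓡 4) X :=
    isBoundaryGluing_reindex ψ hglue
  obtain ⟨Φ⟩ := nonempty_diffeomorph_of_isBoundaryGluing_holds hXg hP
  -- transport
  obtain ⟨h1, h2, -, h3, h4⟩ := def_one_pullback_diffeomorph Φ hts htc htmax
  exact ⟨t.pullback (𝓡 4) Φ, h1, h2, h3, h4⟩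

/-- **Baykur 2006, Thm. 6.1 (folded-symplectic part), for a given Stein gluing.**  A closed
4-manifold `X = W₁ ∪_ψ W₂` glued from two compact Stein domains with matching boundary fields
of complex tangencies carries a folded symplectic form in the sense of
`CannasDaSilva2010_foldedForm_of_orientable`: a `2`-form `s`, a compact `3`-manifold `N` and
`j : N → X` with `IsFoldedForm s N j` (the fold is the seam `H`).
[cite: Baykur2006, Thm. 6.1] [cite: Cannasdasilva2010, Thm. 2] -/
theorem exists_isFoldedForm_of_steinGluing (S₁ : SteinStructure W₁) (S₂ : SteinStructure W₂)
    (b₁ : BoundaryData (𝓡∂ 4) W₁ (𝓡 3)) (b₂ : BoundaryData (𝓡∂ 4) W₂ (𝓡 3))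
    (ψ : b₁.carrier ≃ₘ⟮𝓡 3, 𝓡 3⟯ b₂.carrier)
    (hplane : ∀ z, Submodule.map (mfderiv (𝓡 3) (𝓡∂ 4) (b₂.incl ∘ ψ) z).toLinearMap
      (boundaryPlaneField S₁.J b₁ z) = contactPlane S₂.J (b₂.incl (ψ z)))
    (hglue : IsBoundaryGluing b₁ b₂ ψ (𝓡 4) X) :
    ∃ (s : MForm (𝓡 4) X ℝ 2) (N : Type) (_ : TopologicalSpace N)
      (_ : ChartedSpace (EuclideanSpace ℝ (Fin 3)) N) (_ : IsManifold (𝓡 3) ∞ N)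
      (_ : CompactSpace N) (j : N → X), IsFoldedForm s N j := by
  obtain ⟨s, hs, hc, htr, hmax⟩ := exists_def_one_of_steinGluing S₁ S₂ b₁ b₂ ψ hplane hglue
  obtain ⟨N, i₁, i₂, i₃, i₄, j, h⟩ := exists_isFoldedForm_of_transverse' hs hc htr hmax
  exact ⟨s, N, i₁, i₂, i₃, i₄, j, h⟩

/-- **Baykur 2006, Thm. 6.1 (folded-symplectic part), print-literal hypothesis.**  If
`X = W₁ ∪_ψ W₂` is a gluing of two compact Stein domains such that the induced contact
structures on the seam are *isotopic* — an ambient isotopy `Ψ` of `∂W₂` whose time-one map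
carries `ψ_* ξ₁` onto `ξ₂` — then `X` carries a folded symplectic form: re-glue along `Ψ₁ ∘ ψ`
(`exists_matching_gluing_of_ambientIsotopy`, Gray stability made pointwise) and apply
`exists_isFoldedForm_of_steinGluing`. [cite: Baykur2006, Thm. 6.1] -/
theorem exists_isFoldedForm_of_steinGluing_isotopic (S₁ : SteinStructure W₁)
    (S₂ : SteinStructure W₂) (b₁ : BoundaryData (𝓡∂ 4) W₁ (𝓡 3))
    (b₂ : BoundaryData (𝓡∂ 4) W₂ (𝓡 3)) (ψ : b₁.carrier ≃ₘ⟮𝓡 3, 𝓡 3⟯ b₂.carrier)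
    (Ψ : AmbientIsotopy (𝓡 3) b₂.carrier)
    (hξ : ∀ z, Submodule.map (mfderiv (𝓡 3) (𝓡 3) (Ψ.toFun 1 ∘ ψ) z).toLinearMap
      (boundaryPlaneField S₁.J b₁ z) = boundaryPlaneField S₂.J b₂ (Ψ.toFun 1 (ψ z)))
    (hglue : IsBoundaryGluing b₁ b₂ ψ (𝓡 4) X) :
    ∃ (s : MForm (𝓡 4) X ℝ 2) (N : Type) (_ : TopologicalSpace N)
      (_ : ChartedSpace (EuclideanSpace ℝ (Fin 3)) N) (_ : IsManifold (𝓡 3) ∞ N)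
      (_ : CompactSpace N) (j : N → X), IsFoldedForm s N j := by
  obtain ⟨hT₁, hT₂⟩ := IsBoundaryGluing.t2Space_pieces hglue
  haveI := hT₁
  haveI := hT₂
  obtain ⟨ψ', hψ', hglue'⟩ :=
    exists_matching_gluing_of_ambientIsotopy S₁.J S₂.J b₁ b₂ hglue Ψ hξ
  exact exists_isFoldedForm_of_steinGluing S₁ S₂ b₁ b₂ ψ' hψ' hglue'

end SteinGluing

/-! ### Doubles of compact Stein domains -/

section Doubles

variable {W : Type} [TopologicalSpace W] [ChartedSpace (EuclideanHalfSpace 4) W]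
  [IsManifold (𝓡∂ 4) ∞ W] [CompactSpace W]

/-- **The double of a compact Stein domain is folded symplectic** (Baykur 2006, §6 Example 2:
*"The easiest examples are doubles … When `Y` is indeed Stein, we get a nicely folded
structure"*; Cannas da Silva 2010, §2: *"Doubles of symplectic manifolds with `ω`-convex (or
`ω`-concave) boundary are easy examples of manifolds with folded symplectic forms"*).  Every
closed 4-manifold `X` that is a double `W ∪_{id} W` (`IsDouble`) of a compact Stein domain `W`
of complex dimension `2` carries a folded symplectic form, folded along `∂W`.
[cite: Baykur2006, §6 Example 2] [cite: Cannasdasilva2010, §2] -/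
theorem exists_isFoldedForm_of_isDouble (S : SteinStructure W) (b : BoundaryData (𝓡∂ 4) W (𝓡 3))
    {X : Type} [TopologicalSpace X] [T2Space X] [CompactSpace X]
    [ChartedSpace (EuclideanSpace ℝ (Fin 4)) X] [IsManifold (𝓡 4) ∞ X] (h : IsDouble b (𝓡 4) X) :
    ∃ (s : MForm (𝓡 4) X ℝ 2) (N : Type) (_ : TopologicalSpace N)
      (_ : ChartedSpace (EuclideanSpace ℝ (Fin 3)) N) (_ : IsManifold (𝓡 3) ∞ N)
      (_ : CompactSpace N) (j : N → X), IsFoldedForm s N j := by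
  obtain ⟨W₁, _, _, _, _, W₂, _, _, _, _, S₁, S₂, b₁, b₂, ψ, hplane, hglue⟩ :=
    baykur_conclusion_of_isDouble S b h
  exact exists_isFoldedForm_of_steinGluing S₁ S₂ b₁ b₂ ψ hplane hglue

/-- **Every compact (Hausdorff) Stein domain of complex dimension `2` has a folded symplectic
double**: there is a closed (compact, Hausdorff, second countable) smooth 4-manifold `X` which is
the double `W ∪_{id} W` and carries a folded symplectic form (existence of the double:
`exists_isDouble_and_baykur_conclusion`, `KahlerDecompositionIsotopy.lean`).
[cite: Baykur2006, §6 Example 2] [cite: Cannasdasilva2010, §2] -/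
theorem exists_isDouble_isFoldedForm [T2Space W] (S : SteinStructure W)
    (b : BoundaryData (𝓡∂ 4) W (𝓡 3)) :
    ∃ (X : Type) (_ : TopologicalSpace X) (_ : T2Space X) (_ : SecondCountableTopology X)
      (_ : CompactSpace X) (_ : ChartedSpace (EuclideanSpace ℝ (Fin 4)) X)
      (_ : IsManifold (𝓡 4) ∞ X),
      IsDouble b (𝓡 4) X ∧
      ∃ (s : MForm (𝓡 4) X ℝ 2) (N : Type) (_ : TopologicalSpace N)
        (_ : ChartedSpace (EuclideanSpace ℝ (Fin 3)) N) (_ : IsManifold (𝓡 3) ∞ N)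
        (_ : CompactSpace N) (j : N → X), IsFoldedForm s N j := by
  obtain ⟨X, tX, hX, sX, kX, cX, mX, hD, W₁, _, _, _, _, W₂, _, _, _, _, S₁, S₂, b₁, b₂, ψ,
    hplane, hglue⟩ := exists_isDouble_and_baykur_conclusion S b
  exact ⟨X, tX, hX, sX, kX, cX, mX, hD, exists_isFoldedForm_of_steinGluing S₁ S₂ b₁ b₂ ψ hplane hglue⟩

end Doubles

/-! ### The 4-sphere -/

section Sphere

/-- **`S⁴` carries a folded symplectic form** (Cannas da Silva 2010, §2: *"Simplest instances are
the spheres `S²ⁿ`, where a folded symplectic form is obtained by pulling back the standard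
symplectic form on `ℝ²ⁿ` via the folding map `S²ⁿ → D²ⁿ`"*; Baykur 2006, §3 and §6 Example 2:
the standard folded form `ω₀` on `S⁴` is the double of the standard `D⁴ ⊂ ℂ²`).  Here from the
Kähler decomposition of the round sphere `S⁴ = B⁴ ∪_{id} B⁴` (`baykur_kahlerDecomposition_sphere`,
proved) and `exists_isFoldedForm_of_steinGluing`.
[cite: Cannasdasilva2010, §2] [cite: Baykur2006, §6 Example 2] -/
theorem exists_isFoldedForm_sphere_four :
    ∃ (s : MForm (𝓡 4) (Metric.sphere (0 : EuclideanSpace ℝ (Fin (4 + 1))) 1) ℝ 2) (N : Type)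
      (_ : TopologicalSpace N) (_ : ChartedSpace (EuclideanSpace ℝ (Fin 3)) N)
      (_ : IsManifold (𝓡 3) ∞ N) (_ : CompactSpace N)
      (j : N → Metric.sphere (0 : EuclideanSpace ℝ (Fin (4 + 1))) 1), IsFoldedForm s N j := by
  obtain ⟨W₁, _, _, _, _, W₂, _, _, _, _, S₁, S₂, b₁, b₂, ψ, hplane, hglue⟩ :=
    baykur_kahlerDecomposition_sphere
  exact exists_isFoldedForm_of_steinGluing S₁ S₂ b₁ b₂ ψ hplane hglue

/-- **Every smooth 4-manifold diffeomorphic to `S⁴` carries a folded symplectic form**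
(transport of the Kähler decomposition of the round sphere,
`baykur_kahlerDecomposition_of_diffeomorph_sphere`; Hausdorffness and compactness of `X` come
along the diffeomorphism).
[cite: Cannasdasilva2010, §2] [cite: Baykur2006, §6 Example 2] -/
theorem exists_isFoldedForm_of_diffeomorph_sphere_four (X : Type) [TopologicalSpace X]
    [ChartedSpace (EuclideanSpace ℝ (Fin 4)) X] [IsManifold (𝓡 4) ∞ X]
    (e : Metric.sphere (0 : EuclideanSpace ℝ (Fin (4 + 1))) 1 ≃ₘ⟮𝓡 4, 𝓡 4⟯ X) :
    ∃ (s : MForm (𝓡 4) X ℝ 2) (N : Type) (_ : TopologicalSpace N)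
      (_ : ChartedSpace (EuclideanSpace ℝ (Fin 3)) N) (_ : IsManifold (𝓡 3) ∞ N)
      (_ : CompactSpace N) (j : N → X), IsFoldedForm s N j := by
  haveI : T2Space X := e.toHomeomorph.t2Space
  haveI : CompactSpace X := e.toHomeomorph.compactSpace
  obtain ⟨W₁, _, _, _, _, W₂, _, _, _, _, S₁, S₂, b₁, b₂, ψ, hplane, hglue⟩ :=
    baykur_kahlerDecomposition_of_diffeomorph_sphere X e
  exact exists_isFoldedForm_of_steinGluing S₁ S₂ b₁ b₂ ψ hplane hglue

end Sphere

end Literature.Geometry.Symplectic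

end
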